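import Summits.CriticalPhenomena.Ising3D.Control2DReadoutSpinKernel
import Summits.CriticalPhenomena.Ising3D.Control2DReadoutWindow
import Mathlib.Tactic.Linarith
import Mathlib.Tactic.Positivity
import Mathlib.Tactic.FieldSimp
import Mathlib.Tactic.Ring
import HarnessLib

/-!
# Readout certificates over a WINDOW, spin-`ℓ` channel: the dip value is beaten on a whole interval of dimensions (Bernstein in the
kernel) (cell `pub-ising3x`, seat controls-1 gen 30; KERNEL PATH, certificate kind "readout", continuum form, spin extension —
CONTROL-ONLY)

HONEST FRAMING: lottery ticket; floor = tightest certified 3D Ising CFT bounds; no exact-solution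
claim without a proof. CONTROL-ONLY (`d = 2`, `Δ_σ = 1/8`); nothing numerical is asserted here.

`Control2DReadoutWindow` (controls-1 g29) certifies `f(m) < f(Δ)` on a whole cell of dimensions for the SCALAR action. This file is
its spin-`ℓ` twin, for `f(x) = φ[F^{1/8}_-[g_{x,ℓ}]]` and the point readouts of `Control2DReadoutSpinKernel`: with `y = (Δ - ℓ)/2`,
the truncated action is the landed integer cell polynomial of the spin-`ℓ` cells obligation over a positive factor
(`evalR_cellPolyZ`: `P̂_ℓ(y) = C · D_ℓ(y) D_0(y) · halfPow(Δ)⁻¹ · φ[F_-[Q_{Nd+1}(Δ,ℓ)]]`, `C = 8^Λ Λ!² 4^{Nd}`, `D_c = denProd Nd c`;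
`cellConst_spin_eq`), it bounds the full action from BELOW when the dropped pairs are non-negative (`phi_QN_le_block_taylor`, any `ℓ`,
under the certificate's region obligation (R), `Δ + Nd + 1 ≥ E₀`), the dip's UPPER enclosure is `f(m) ≤ halfPow(m) · U`
(`blockAction_mem_spin`, `U = headSpinQf + errSpinQ`), and Bernstein positivity of the WINDOW POLYNOMIAL `G = P̂_ℓ - B · D_ℓ D_0`,
`B = ⌊U·C⌋ + 1`, on its leading digits (`bernAuto (ptrunc G t)`) gives `φ[F[Q]] ≥ halfPow(Δ) · U > halfPow(m) · U ≥ f(m)` for `Δ < m`.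
ONE Boolean `windowCheckSpin … = true` per cell (`window_lt_of_windowCheckSpin`). First use: the spin-2 windows `[49/16, m_Λ - 3/100]` of
the C-F objects (`Control2DReadoutWindowSpin2B*`; the spin-2 action has its binding zero at the twist threshold `Δ = 3`, hence the
window start `3 + 1/16`). Elementary; no facts, standard axioms only. [cite: RattazziEtAl2008, §5.5]
-/

namespace Summit.CriticalPhenomena.Ising3D.Control2D

open Finset Set
open Literature.Analysis.ValidatedNumerics.PolyMP
open Literature.MathematicalPhysics.QuantumFieldTheory.ConformalBootstrap3D

/-- `cellConst` for spin `ℓ`, factored: `C · D_ℓ(y) D_0(y) · (halfPow Δ)⁻¹` with `C = 8^Λ Λ!² 4^{Nd}`, `y = (Δ-ℓ)/2`. [folklore] -/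
theorem cellConst_spin_eq (Λ ℓ Nd : ℕ) (Δ : ℝ) :
    cellConst Λ ℓ Nd Δ =
      (8 : ℝ) ^ Λ * (Λ.factorial : ℝ) * (Λ.factorial : ℝ) * (4 : ℝ) ^ Nd *
        (denProd Nd ℓ ((Δ - ℓ) / 2) * denProd Nd 0 ((Δ - ℓ) / 2)) * (halfPow Δ)⁻¹ := by
  unfold cellConst halfPow
  ring

/-- **The spin-`ℓ` window polynomial** `G = P̂_ℓ − B · D_ℓ(y) D_0(y)`, `B = windowMult Λ Nd U`. [folklore] -/
def windowPolySpinZ (P : List ℤ) (Λ ℓ Nd : ℕ) (U : ℚ) : List ℤ :=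
  zadd P (zsmul (-windowMult Λ Nd U) (zmul (denProdZ Nd ℓ) (denProdZ Nd 0)))

/-- **The spin-`ℓ` window check** (`Δ_σ = 1/8`) for the integer table `wt` on `Sl` with cell polynomial `P = cellPolyZ wt Sl Λ ℓ Nd`
(supplied as a literal), readout truncation `N`, room `k`, dip point `m`, cell `[a/q, (a+L)/q]` in `y = (Δ-ℓ)/2`, region threshold `E₀`,
digit cut `t`: positivity of the dip's upper enclosure `U`, the rounding inequality `U·C ≤ B`, ranges, `2(a+L)/q + ℓ < m`,
`E₀ ≤ 2a/q + ℓ + Nd + 1`, and `bernAuto (ptrunc (windowPolySpinZ P Λ ℓ Nd U) t) q a L`. [folklore] -/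
def windowCheckSpin (wt : ℕ × ℕ → ℤ) (Sl : List (ℕ × ℕ)) (Λ ℓ k Nd t N E₀ : ℕ) (m : ℚ) (q a L : ℤ) (P : List ℤ) : Bool :=
  let U : ℚ := headSpinQf wt Sl (1 / 8) ((m + ℓ) / 2) ((m - ℓ) / 2) N Λ + errSpinQ wt Sl ℓ k N Λ
  decide (0 < U) && decide (U * (cellConstZ Λ Nd : ℚ) ≤ (windowMult Λ Nd U : ℚ)) &&
    decide (0 < q) && decide (0 ≤ a) && decide (0 ≤ L) && rangeOkSpin ℓ k m && decide (0 < k) &&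
    decide (Λ < N + (k + ℓ) + 2) &&
    decide (2 * ((a : ℚ) + L) / q + ℓ < m) && decide ((E₀ : ℚ) ≤ 2 * (a : ℚ) / q + ℓ + (Nd + 1)) &&
    bernAuto (ptrunc (windowPolySpinZ P Λ ℓ Nd U) t) q a L

/-- **Soundness of the spin-`ℓ` window check**: with `P = cellPolyZ wt Sl Λ ℓ Nd` and the certificate's region obligation (R) at threshold
`E₀`, `windowCheckSpin … = true` gives `f(m) < f(Δ)` for every `Δ ∈ [2a/q + ℓ, 2(a+L)/q + ℓ]` (`f(x) = φ[F^{1/8}_-[g_{x,ℓ}]]`,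
`φ = taylorFunctional2D (1/2) Sl.toFinset wt`). [cite: RattazziEtAl2008, §5.5] -/
theorem window_lt_of_windowCheckSpin (wt : ℕ × ℕ → ℤ) {Sl : List (ℕ × ℕ)} (hnd : Sl.Nodup) {Λ : ℕ}
    (hdeg : ∀ p ∈ Sl, p.1 + p.2 ≤ Λ) {ℓ k Nd t N E₀ : ℕ} {m : ℚ} {q a L : ℤ} {P : List ℤ}
    (hP : cellPolyZ wt Sl Λ ℓ Nd = P)
    (hR : ∀ (b : ℝ) (J : ℕ), 0 ≤ b → (E₀ : ℝ) ≤ 2 * b + J →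
      0 ≤ ∑ p ∈ Sl.toFinset, (wt p : ℝ) * ((1 - (-1 : ℝ) ^ (p.1 + p.2)) * 2 ^ (p.1 + p.2) *
        (qFactor₁ (1 / 8) (b + J) p.1 * qFactor₁ (1 / 8) b p.2 + qFactor₁ (1 / 8) b p.1 * qFactor₁ (1 / 8) (b + J) p.2)))
    (hchk : windowCheckSpin wt Sl Λ ℓ k Nd t N E₀ m q a L P = true) {Δ : ℝ}
    (hlo : 2 * (a : ℝ) / q + ℓ ≤ Δ) (hhi : Δ ≤ 2 * ((a : ℝ) + L) / q + ℓ) :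
    taylorFunctional2D (1 / 2) Sl.toFinset (fun p => (wt p : ℝ)) (crossF (1 / 8) (-1) (globalBlock (m : ℝ) ℓ)) <
      taylorFunctional2D (1 / 2) Sl.toFinset (fun p => (wt p : ℝ)) (crossF (1 / 8) (-1) (globalBlock Δ ℓ)) := by
  set φ := taylorFunctional2D (1 / 2) Sl.toFinset (fun p => (wt p : ℝ)) with hφdef
  unfold windowCheckSpin at hchk
  simp only [Bool.and_eq_true, decide_eq_true_eq, headSpinQf_eq_headSpinQ wt hdeg] at hchk
  obtain ⟨⟨⟨⟨⟨⟨⟨⟨⟨⟨hU0, hB⟩, hq⟩, ha⟩, hL⟩, hm⟩, hk⟩, hN⟩, htop⟩, hE⟩, hbern⟩ := hchk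
  set U : ℚ := headSpinQ wt Sl (1 / 8) ((m + ℓ) / 2) ((m - ℓ) / 2) N + errSpinQ wt Sl ℓ k N Λ with hUdef
  obtain ⟨hm0, hm1⟩ := rangeOkSpin_sound hm
  -- real casts of the check's facts
  have hqR : (0 : ℝ) < q := by exact_mod_cast hq
  have haR : (0 : ℝ) ≤ a := by exact_mod_cast ha
  have hℓ0 : (0 : ℝ) ≤ (ℓ : ℝ) := Nat.cast_nonneg ℓ
  set y : ℝ := (Δ - ℓ) / 2 with hydef
  have hy0 : 0 ≤ y := by
    have : 0 ≤ 2 * (a : ℝ) / q := by positivity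
    rw [hydef]; linarith
  have hℓΔ : (ℓ : ℝ) ≤ Δ := by linarith
  have hΔm : Δ < (m : ℝ) := by
    have h1 : (((2 * ((a : ℚ) + L) / q + ℓ : ℚ)) : ℝ) < (m : ℝ) := by exact_mod_cast htop
    push_cast at h1
    linarith
  have hEΔ : (E₀ : ℝ) ≤ Δ + ((Nd + 1 : ℕ) : ℝ) := by
    have h1 : (((E₀ : ℚ)) : ℝ) ≤ (((2 * (a : ℚ) / q + ℓ + (Nd + 1) : ℚ)) : ℝ) := by exact_mod_cast hE
    push_cast at h1 ⊢
    linarith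
  -- (1) the dip's upper enclosure
  obtain ⟨-, hUm⟩ := blockAction_mem_spin wt hnd hdeg ℓ hk hm0 hm1 hN
  have hUpos : (0 : ℝ) < (U : ℝ) := by exact_mod_cast hU0
  -- (2) the window polynomial is non-negative at `y`
  have hG := evalR_nonneg_of_bernAuto hq hL hbern (x := y)
    (by
      have e : (a : ℝ) / q = (2 * (a : ℝ) / q + ℓ - ℓ) / 2 := by ring
      rw [e, hydef]; linarith)
    (by
      have e : ((a : ℝ) + L) / q = (2 * ((a : ℝ) + L) / q + ℓ - ℓ) / 2 := by ring
      rw [e, hydef]; linarith)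
  -- unfold its value
  set C : ℤ := cellConstZ Λ Nd with hCdef
  set B : ℤ := windowMult Λ Nd U with hBdef
  have hCR : ((C : ℤ) : ℝ) = (8 : ℝ) ^ Λ * (Λ.factorial : ℝ) * (Λ.factorial : ℝ) * (4 : ℝ) ^ Nd := by
    rw [hCdef, cellConstZ]; push_cast; ring
  have hCpos : (0 : ℝ) < ((C : ℤ) : ℝ) := by rw [hCR]; positivity
  set Dv : ℝ := denProd Nd ℓ y * denProd Nd 0 y with hDv
  have hDpos : 0 < Dv := by
    have h1 : 0 < denProd Nd ℓ y := denProd_pos Nd ℓ (by linarith)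
    have h2 : 0 < denProd Nd 0 y := denProd_pos Nd 0 (by push_cast; linarith)
    exact mul_pos h1 h2
  have hGval : evalR (castZ (windowPolySpinZ P Λ ℓ Nd U)) y = evalR (castZ P) y - (B : ℝ) * Dv := by
    rw [windowPolySpinZ, evalR_zadd, evalR_zsmul, evalR_zmul, evalR_denProdZ, evalR_denProdZ, ← hBdef, hDv]
    push_cast
    ring
  -- (3) truncation and rounding: `P̂(y) ≥ B·D_ℓ D_0 ≥ U·C·D_ℓ D_0`
  have htr := pow_mul_evalR_ptrunc_le t hy0 (windowPolySpinZ P Λ ℓ Nd U)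
  rw [hGval] at htr
  have hBR : ((U : ℚ) : ℝ) * ((C : ℤ) : ℝ) ≤ ((B : ℤ) : ℝ) := by exact_mod_cast hB
  have hPy : (U : ℝ) * ((C : ℤ) : ℝ) * Dv ≤ evalR (castZ P) y := by
    have h10 : (0 : ℝ) < (10 : ℝ) ^ t := by positivity
    nlinarith [mul_le_mul_of_nonneg_right hBR hDpos.le, mul_nonneg h10.le hG]
  -- (4) `P̂(y) = cellConst · φ[F[Q]]`, `cellConst = C·D_ℓ D_0·halfPow⁻¹`
  have hcell := evalR_cellPolyZ wt hnd hdeg ℓ Nd hℓΔ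
  rw [hP, ← hydef, cellConst_spin_eq, ← hCR] at hcell
  rw [← hydef, ← hDv] at hcell
  have hhp := halfPow_pos Δ
  -- φ[F[Q]] ≥ halfPow Δ · U
  have hQ : (U : ℝ) * halfPow Δ ≤ φ (crossF (1 / 8) (-1) (QN (Nd + 1) ℓ Δ)) := by
    set φQ : ℝ := φ (crossF (1 / 8) (-1) (QN (Nd + 1) ℓ Δ)) with hφQ
    have hpos : 0 < ((C : ℤ) : ℝ) * Dv := by positivity
    have h1 : (U : ℝ) * (((C : ℤ) : ℝ) * Dv) ≤ ((halfPow Δ)⁻¹ * φQ) * (((C : ℤ) : ℝ) * Dv) := by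
      calc (U : ℝ) * (((C : ℤ) : ℝ) * Dv) = (U : ℝ) * ((C : ℤ) : ℝ) * Dv := by ring
        _ ≤ evalR (castZ P) y := hPy
        _ = ((halfPow Δ)⁻¹ * φQ) * (((C : ℤ) : ℝ) * Dv) := by rw [hcell]; ring
    have h2 : (U : ℝ) ≤ (halfPow Δ)⁻¹ * φQ := le_of_mul_le_mul_right h1 hpos
    calc (U : ℝ) * halfPow Δ ≤ ((halfPow Δ)⁻¹ * φQ) * halfPow Δ := mul_le_mul_of_nonneg_right h2 hhp.le
      _ = φQ := by field_simp
  -- (5) truncation is a lower bound (dropped pairs ≥ 0 under (R))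
  have hpair : PairPositiveAbove φ (1 / 8) E₀ := pairPositiveAbove_half_of_poly Sl.toFinset _ hR
  have hle := phi_QN_le_block_taylor (isTaylorFunctional_taylorFunctional2D (1 / 2) Sl.toFinset _) (by norm_num)
    (by norm_num) hpair (ℓ := ℓ) (N := Nd + 1) hℓΔ hEΔ
  -- (6) compare with the dip
  have hlt : (U : ℝ) * halfPow (m : ℝ) < (U : ℝ) * halfPow Δ :=
    mul_lt_mul_of_pos_left (halfPow_lt_halfPow hΔm) hUpos
  calc φ (crossF (1 / 8) (-1) (globalBlock (m : ℝ) ℓ))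
      ≤ halfPow (m : ℝ) *
          ((headSpinQ wt Sl (1 / 8) ((m + ℓ) / 2) ((m - ℓ) / 2) N + errSpinQ wt Sl ℓ k N Λ : ℚ) : ℝ) := hUm
    _ = (U : ℝ) * halfPow (m : ℝ) := by rw [hUdef]; ring
    _ < (U : ℝ) * halfPow Δ := hlt
    _ ≤ φ (crossF (1 / 8) (-1) (QN (Nd + 1) ℓ Δ)) := hQ
    _ ≤ φ (crossF (1 / 8) (-1) (globalBlock Δ ℓ)) := hle

end Summit.CriticalPhenomena.Ising3D.Control2D
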